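import Summits.CriticalPhenomena.SAWScalingLimit.Theorems.SAWDevelopingMapHexTightPerShellAtoms
import Summits.CriticalPhenomena.SAWScalingLimit.Theorems.SAWDevelopingMapHexTightOnFrontierPerShellTight
import Summits.CriticalPhenomena.SAWScalingLimit.Theorems.SAWDevelopingMapHexTightVirginizationTight
import Summits.CriticalPhenomena.SAWScalingLimit.Theorems.SAWDevelopingMapHexTightArcTightOfPinchDecay
import Summits.CriticalPhenomena.SAWScalingLimit.Theorems.SAWDevelopingMapHexTightRootedTightOfPinchDecay
import Summits.CriticalPhenomena.SAWScalingLimit.Theorems.SAWDevelopingMapHexTightTravLocalization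
import Summits.CriticalPhenomena.SAWScalingLimit.Theorems.SAWDevelopingMapHexTightVertexToCurve
import HarnessLib

/-!
# `HexTight` from the two atoms of the line `reversal-virgin-disc` (stmt-CriticalPhenomena-5423)

Crux `Summit.CriticalPhenomena.SAWScalingLimit.Theses.SAWDevelopingMap.HexTight` (eventual tightness of the critical
hexagonal SAW laws), line `reversal-virgin-disc`, seat c4 (`prover-line-stmt-CriticalPhenomena-5423-c4-0`).

This file records, as sorry-free CONDITIONAL theorems under `Theorems/` (independent of the Cruxes work file
`Cruxes/HexTight/Lines/reversal_virgin_disc.lean`), the complete composition of the line: the crux follows from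
exactly two a-priori estimates for the critical hexagonal self-avoiding walk, both stated INLINE as hypotheses —

* the **interior atom `PinchDecay`** (lattice-local): for SOME threshold `k ≥ 1`, SOME rate `φ ≥ 0` with
  `φ(t) = o(t)` (`t → 0⁺`) and SOME `N₀`, uniformly over configurations `(H, Λ)` virgin at radius `N ≥ N₀` about
  `z₀` (arbitrary exterior) and rim doors `w, w'`, for `1 ≤ η ≤ N/4` the `x_c`-mass of `H`-arcs `w → w'` whose
  polyline makes `k` separate traversals of `D(z₀; η, N/2)` is `≤ φ(η/N) ·` (arc mass)
  (Aizenman–Burchard's (H1) at one threshold with a rate just better than linear; heuristic value at threshold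
  `2j`: `(η/N)^{(9j²-1)/12}`);
* the **boundary atom `OnFrontierPerShellTight`** (law-level, per domain): per-shell, rate-free tightness of the
  traversal number on thin shells `D(x; ρ, R)`, `4ρ < R ≤ 1`, centred at a point `x` of the Jordan curve
  `frontier D.carrier`, eventually in the mesh — a verbatim piece of the crux
  (`BoundaryOnFrontier.perShellTight_of_hexTight`).

Main results:
* `hexTight_of_pinchDecay_of_onFrontierPerShellTight` — the two atoms give `HexTight` (glue: `stub_vertexToCurve`,
  `stub_travLocalization`, `stub_arcTightOfPinchDecay`, `stub_rootedTightOfPinchDecay`, `stub_virginizationTight`,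
  `interiorPerShellTight_of_interiorBound_one`, `hexTight_of_interiorThin_of_onFrontier`, all landed);
* `hexTight_of_arcPinchBound_of_onFrontierPerShellTight` — the r7 power form `Reversal.ArcPinchBound` (threshold `4`,
  exponent `1 + s`) in place of `PinchDecay`;
* `hexTight_of_pinchDecay_of_onFrontierDecay` — the one-threshold rate form of the boundary atom instead;
* `interiorThinPerShellTight_of_pinchDecay` — the lattice-local interior atom implies the law-level interior piece of
  the crux (thin-interior per-shell tightness), so with `hexTight_iff_interiorThin_and_onFrontier` (p111202) the open
  content of the crux is EXACTLY {thin-interior per-shell tightness, on-frontier per-shell tightness}, and `PinchDecay`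
  is a sufficient lattice form of the first.

Both atoms are OPEN (no RSW/FKG technology for the `n = 0` loop model; every parafermionic identity is exit-summed
while both atoms are ratios pinned at two endpoints); they are the statements a planner would file as conjecture items
to record `HexTight` as conditional on them. Nothing here is asserted unconditionally about the SAW. The statements
are spelled as arrow chains (the registered sub-goal signatures, verbatim).

References: M. Aizenman, A. Burchard, Duke Math. J. 99 (1999) §1–2; H. Duminil-Copin, S. Smirnov, Ann. of Math. 175
(2012); A. Kemppainen, S. Smirnov, Ann. Probab. 45 (2017) §2.
-/

noncomputable section

open scoped BigOperators Classical ENNReal NNReal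
open MeasureTheory Filter Topology Set Metric
open Literature.Probability.LatticeModels Literature.Probability.RandomPlanarGeometry
  Literature.Probability.RandomPlanarGeometry.SAW

namespace Summit.CriticalPhenomena.SAWScalingLimit.Theorems.HexTight.Reversal

open Summit.CriticalPhenomena.SAWScalingLimit.Theorems.HexTight.ExponentBootstrap
open Summit.CriticalPhenomena.SAWScalingLimit.Theorems.HexTight.BoundaryOnFrontier

/-- **Thin-interior per-shell tightness from pinch decay.** The lattice-local interior atom `PinchDecay` (first
hypothesis) implies, for every Dobrushin domain and endpoint approximation, per-shell rate-free tightness of the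
traversal number on every thin shell whose closed outer disc lies in the domain: `PinchDecay` ⇒ chordal and rooted
rate-free tightness in virgin discs (`stub_arcTightOfPinchDecay`, `stub_rootedTightOfPinchDecay`, over
`stub_travLocalization stub_vertexToCurve`) ⇒ interior (H1) with exponent `3` (`stub_virginizationTight`) ⇒
thin-interior per-shell tightness (`interiorPerShellTight_of_interiorBound_one`). -/
theorem interiorThinPerShellTight_of_pinchDecay :
    (∃ (k : ℕ) (φ : ℝ → ℝ) (N₀ : ℝ), 1 ≤ k ∧ 0 < N₀ ∧ (∀ t : ℝ, 0 ≤ φ t) ∧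
      (∀ ε : ℝ, 0 < ε → ∃ t₀ : ℝ, 0 < t₀ ∧ ∀ t : ℝ, 0 < t → t ≤ t₀ → φ t ≤ ε * t) ∧
      ∀ (H : SimpleGraph HexVertex) (Λ : Finset HexVertex) (z₀ : ℂ) (η N : ℝ) (w w' : Sym2 HexVertex),
        N₀ ≤ N → 1 ≤ η → η ≤ N / 4 → IsVirgin H Λ z₀ N → Straddles Λ z₀ N w → Straddles Λ z₀ N w' →
        travMass H Λ w w' k z₀ η (N / 2) ≤ φ (η / N) * arcMass H Λ w w') →
    ∀ (D : DobrushinDomain) (a b : ℝ → HexVertex), IsEmbEndpointApprox hexGraph hexCenter D a b →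
      ∀ (x : ℂ) (ρ R : ℝ), 0 < ρ → 4 * ρ < R → R ≤ 1 → Metric.closedBall x R ⊆ D.carrier → ∀ η : ℝ, 0 < η →
        ∃ (k : ℕ) (δ₁ : ℝ), 0 < δ₁ ∧ ∀ δ ∈ Set.Ioc (0 : ℝ) δ₁, δ ≤ ρ →
          hexSAWLaw D.carrier δ (a δ) (b δ)
            {γ | (⟨γ.walk.toCurve fun v => (δ : ℂ) * hexCenter v⟩ : Curve ℂ).HasTraversals k x ρ R} ≤
            ENNReal.ofReal η := by
  intro hC D a b hab
  have hTL := stub_travLocalization stub_vertexToCurve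
  obtain ⟨k, K, lam, δ₀, hK, hlam, hδ₀, h⟩ :=
    stub_virginizationTight (stub_arcTightOfPinchDecay hTL hC) (stub_rootedTightOfPinchDecay hTL hC) D a b hab
  exact interiorPerShellTight_of_interiorBound_one D.carrier a b ⟨k, K, lam, δ₀, hK, by linarith, hδ₀, h⟩

/-- **`HexTight` from the two atoms of the line `reversal-virgin-disc`.** If the critical hexagonal SAW satisfies
(i) the interior lattice-local pinch decay `PinchDecay` (first hypothesis) and (ii) per-shell rate-free tightness of
the traversal number on thin shells centred on the Jordan curve (second hypothesis), then the critical hexagonal SAW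
laws are tight along the mesh for every Dobrushin domain and endpoint approximation
(`hexTight_of_interiorThin_of_onFrontier` over `interiorThinPerShellTight_of_pinchDecay`). CONDITIONAL: both
hypotheses are open a-priori estimates. -/
theorem hexTight_of_pinchDecay_of_onFrontierPerShellTight :
    (∃ (k : ℕ) (φ : ℝ → ℝ) (N₀ : ℝ), 1 ≤ k ∧ 0 < N₀ ∧ (∀ t : ℝ, 0 ≤ φ t) ∧
      (∀ ε : ℝ, 0 < ε → ∃ t₀ : ℝ, 0 < t₀ ∧ ∀ t : ℝ, 0 < t → t ≤ t₀ → φ t ≤ ε * t) ∧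
      ∀ (H : SimpleGraph HexVertex) (Λ : Finset HexVertex) (z₀ : ℂ) (η N : ℝ) (w w' : Sym2 HexVertex),
        N₀ ≤ N → 1 ≤ η → η ≤ N / 4 → IsVirgin H Λ z₀ N → Straddles Λ z₀ N w → Straddles Λ z₀ N w' →
        travMass H Λ w w' k z₀ η (N / 2) ≤ φ (η / N) * arcMass H Λ w w') →
    (∀ (D : DobrushinDomain) (a b : ℝ → HexVertex), IsEmbEndpointApprox hexGraph hexCenter D a b →
      ∀ (x : ℂ) (ρ R : ℝ), 0 < ρ → 4 * ρ < R → R ≤ 1 → x ∈ frontier D.carrier → ∀ η : ℝ, 0 < η →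
        ∃ (k : ℕ) (δ₁ : ℝ), 0 < δ₁ ∧ ∀ δ ∈ Set.Ioc (0 : ℝ) δ₁, δ ≤ ρ →
          hexSAWLaw D.carrier δ (a δ) (b δ)
            {γ | (⟨γ.walk.toCurve fun v => (δ : ℂ) * hexCenter v⟩ : Curve ℂ).HasTraversals k x ρ R} ≤
            ENNReal.ofReal η) →
    Summit.CriticalPhenomena.SAWScalingLimit.Theses.SAWDevelopingMap.HexTight :=
  fun hC hF => hexTight_of_interiorThin_of_onFrontier (interiorThinPerShellTight_of_pinchDecay hC) hF

/-- **`HexTight` from the r7 power form of the interior atom.** `Reversal.ArcPinchBound` (two-strand pinch power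
bound: threshold `4`, rate `K t^{1+s}`, `s > 0`, uniform over virgin discs) implies `PinchDecay` with `k = 4` and
`φ(t) = K (max t 0)^{1+s}` (which is `o(t)`), hence with the boundary atom it also gives the crux. -/
theorem hexTight_of_arcPinchBound_of_onFrontierPerShellTight :
    ArcPinchBound →
    (∀ (D : DobrushinDomain) (a b : ℝ → HexVertex), IsEmbEndpointApprox hexGraph hexCenter D a b →
      ∀ (x : ℂ) (ρ R : ℝ), 0 < ρ → 4 * ρ < R → R ≤ 1 → x ∈ frontier D.carrier → ∀ η : ℝ, 0 < η →
        ∃ (k : ℕ) (δ₁ : ℝ), 0 < δ₁ ∧ ∀ δ ∈ Set.Ioc (0 : ℝ) δ₁, δ ≤ ρ →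
          hexSAWLaw D.carrier δ (a δ) (b δ)
            {γ | (⟨γ.walk.toCurve fun v => (δ : ℂ) * hexCenter v⟩ : Curve ℂ).HasTraversals k x ρ R} ≤
            ENNReal.ofReal η) →
    Summit.CriticalPhenomena.SAWScalingLimit.Theses.SAWDevelopingMap.HexTight := by
  intro hC hF
  refine hexTight_of_pinchDecay_of_onFrontierPerShellTight ?_ hF
  obtain ⟨s, K, N₀, hs, hK, hN₀, h⟩ := hC
  refine ⟨4, fun t => K * (max t 0) ^ (1 + s), N₀, by norm_num, hN₀, fun t => ?_, fun ε hε => ?_, ?_⟩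
  · exact mul_nonneg hK (Real.rpow_nonneg (le_max_right _ _) _)
  · -- `K t^{1+s} ≤ ε t` as soon as `t ≤ (ε/(K+1))^{1/s}`
    refine ⟨(ε / (K + 1)) ^ s⁻¹, Real.rpow_pos_of_pos (by positivity) _, fun t ht htle => ?_⟩
    have hq : 0 ≤ ε / (K + 1) := by positivity
    show K * (max t 0) ^ (1 + s) ≤ ε * t
    rw [max_eq_left ht.le, Real.rpow_add ht, Real.rpow_one]
    have h1 : t ^ s ≤ ε / (K + 1) := by
      calc t ^ s ≤ ((ε / (K + 1)) ^ s⁻¹) ^ s := Real.rpow_le_rpow ht.le htle hs.le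
        _ = ε / (K + 1) := Real.rpow_inv_rpow hq hs.ne'
    calc K * (t * t ^ s) = (K * t ^ s) * t := by ring
      _ ≤ ((K + 1) * (ε / (K + 1))) * t := by
          refine mul_le_mul_of_nonneg_right ?_ ht.le
          exact mul_le_mul (by linarith) h1 (Real.rpow_nonneg ht.le _) (by linarith)
      _ = ε * t := by field_simp
  · intro H Λ z₀ η N w w' hN hη hηN hV hw hw'
    have hpos : 0 < η / N := div_pos (by linarith) (by linarith)
    simpa [max_eq_left hpos.le] using h H Λ z₀ η N w w' hN hη hηN hV hw hw'

/-- **`HexTight` from pinch decay and the one-threshold rate form of the boundary atom** (`OnFrontierDecay`: for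
each `(D, a, b)` and outer radius `R ≤ 1` ONE threshold `k` and ONE rate `φ(ρ) = o(ρ)`, uniform over the points of
the Jordan curve): by `hexTight_of_interiorBound_one_of_onFrontierDecay` (p117056) over the interior (H1) with
exponent `3` delivered by `PinchDecay`. -/
theorem hexTight_of_pinchDecay_of_onFrontierDecay :
    (∃ (k : ℕ) (φ : ℝ → ℝ) (N₀ : ℝ), 1 ≤ k ∧ 0 < N₀ ∧ (∀ t : ℝ, 0 ≤ φ t) ∧
      (∀ ε : ℝ, 0 < ε → ∃ t₀ : ℝ, 0 < t₀ ∧ ∀ t : ℝ, 0 < t → t ≤ t₀ → φ t ≤ ε * t) ∧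
      ∀ (H : SimpleGraph HexVertex) (Λ : Finset HexVertex) (z₀ : ℂ) (η N : ℝ) (w w' : Sym2 HexVertex),
        N₀ ≤ N → 1 ≤ η → η ≤ N / 4 → IsVirgin H Λ z₀ N → Straddles Λ z₀ N w → Straddles Λ z₀ N w' →
        travMass H Λ w w' k z₀ η (N / 2) ≤ φ (η / N) * arcMass H Λ w w') →
    (∀ (D : DobrushinDomain) (a b : ℝ → HexVertex), IsEmbEndpointApprox hexGraph hexCenter D a b →
      ∀ R : ℝ, 0 < R → R ≤ 1 → ∃ (k : ℕ) (φ : ℝ → ℝ),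
        (∀ ε : ℝ, 0 < ε → ∃ t₀ : ℝ, 0 < t₀ ∧ ∀ t : ℝ, 0 < t → t ≤ t₀ → φ t ≤ ε * t) ∧
        ∀ x ∈ frontier D.carrier, ∀ ρ : ℝ, 0 < ρ → 4 * ρ < R →
          ∃ δ₁ : ℝ, 0 < δ₁ ∧ ∀ δ ∈ Set.Ioc (0 : ℝ) δ₁, δ ≤ ρ →
            hexSAWLaw D.carrier δ (a δ) (b δ)
              {γ | (⟨γ.walk.toCurve fun v => (δ : ℂ) * hexCenter v⟩ : Curve ℂ).HasTraversals k x ρ R} ≤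
              ENNReal.ofReal (φ ρ)) →
    Summit.CriticalPhenomena.SAWScalingLimit.Theses.SAWDevelopingMap.HexTight := by
  intro hC hG
  refine hexTight_of_interiorBound_one_of_onFrontierDecay (fun D a b hab => ?_) hG
  have hTL := stub_travLocalization stub_vertexToCurve
  obtain ⟨k, K, lam, δ₀, hK, hlam, hδ₀, h⟩ :=
    stub_virginizationTight (stub_arcTightOfPinchDecay hTL hC) (stub_rootedTightOfPinchDecay hTL hC) D a b hab
  exact ⟨k, K, lam, δ₀, hK, by linarith, hδ₀, h⟩

end Summit.CriticalPhenomena.SAWScalingLimit.Theorems.HexTight.Reversal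

end
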